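import Summits.ResolutionOfSingularities.ResolutionOfSingularities.Theorems.FrobeniusClosingSteerWords23HeightSplitH

/-!
# Crux `Steer` (stmt-ResolutionOfSingularities-16345), line `switching-dichotomy` — WORDS 24: the TAME / WILD steps of a constant-order chain (was §σ2.26b; ASIDE vocabulary: `IsTameStep`, `NoEternalConstOrderIsolatedChainTame` / `…Wild` and glue) (HOIST of the registered skeleton r49 bb092f8f650aca19, l.2236–2338, inside `section HeightSplitTwo` with its `variable {K : Type} [Field K]`)

Holder res-L0-w41-lead-1 g6 on res-L0-w41-plan-1 RULING 47 (E1) / 104b; see `…Words01Core` for the hoist protocol (bodies byte for byte;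
`[cite: …]` / `[folklore]` tags on CLOSED `def … : Prop` words are written «(ref. …)» / «(folklore)» — GATE NOTE of `…Words02Stubs`;
cite keys inside `[cite:]` tags normalised to `references.bib` keys where needed, as in `…Words03Phases`).
Nothing here is a statement of the manuscript [claim: Hironaka2017, status: under-review]. OURS (candidates / vocabulary; AI review is
weaker than expert review).
-/

open Summit.ResolutionOfSingularities.ResolutionOfSingularities.Theses.FrobeniusClosing (IsolatedForcedTermination)
open Literature.AlgebraicGeometry.Resolution (IsAbhyankarPlace FGOver exists_ringKrullDim_eq_and_trdeg_eq
  trdeg_eq_trdeg_of_isFractionRing locAtCentre IsQuadraticTransformAlong SubringDominates IsRsopPart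
  LocalUniformization3 RelLocalUniformization CossartPiltant2019General)
open Summit.ResolutionOfSingularities.ResolutionOfSingularities.Theorems.SteerRankThinness
  (HasProperCoarsening concl_of_hasProperCoarsening rankOne_of_not_hasProperCoarsening)
open Summit.ResolutionOfSingularities.ResolutionOfSingularities.Theorems.PfaffLine

set_option linter.dupNamespace false

namespace Summit.ResolutionOfSingularities.ResolutionOfSingularities.Theorems.SwitchingDichotomy.Words

section SteeredTwo

open IsLocalRing
open Literature.AlgebraicGeometry.Resolution (IsLocalBlowupAlong IsQuadraticTransform IsExcellentRing)

variable {K : Type} [Field K]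


/-- **T-LINE CANDIDATE slate7 (r34 + §σ2.26 v2)** — plan-1 RULING 86d's shape, assembled from the leaves of record (slate3–slate6 bodies):
T ⇐ FRONTIER {F-A1 `hB₂` · F-A2 `hC₂` · F-B-wild `hFBw` · G-TAME(4) `hG4` · W(3) `hW3`} · RUNG {G-perf(3) `hG3` (idea-3)} ·
WORK {Θ♮ `hΘ` (packaging into the perfect K♭ v2.2 chain; pv-003 after hA3 / pool) · F-A3 Θ1♭ + (L7) `hA3 : StrippedThreadTwoNH` (pv-003 `strippedThreadTwoNH_holds`,
pv-004 (L7); RULING 90 (ii)) · D3a `hD3a` (pv-012) · D3c `hD3c` (062)} · FACTS {Lipman 1978 (A) `hL'`, Cossart–Piltant 2019 `hCP'`}; (B2) res-type-096 and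
(C) res-D-pv-011 are DISCHARGED by name inside (`derivationStepTransfer_holds`, `cleaningExact_holds`). 12 binders; count of registered stubs
unchanged (the six). The holder decides whether this becomes the line of record. Pure logic. OURS. [folklore] -/
theorem eternalSteeredRunTwo_of_slate7
    (hΘ : PointTailChainTwoN) (hFBw : StrippingTailWildConclTwoN)
    (hB₂ : BirthWanderHighConclTwoN) (hC₂ : BranchWanderHighConclTwoN)
    (hA3 : StrippedThreadTwoNH)
    (hG4 : ∀ p : ℕ, p.Prime → ∀ e : ℕ, 2 ≤ e → NoEternalConstOrderIsolatedChainPerfect p 4 (p * e))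
    (hG3 : ∀ p : ℕ, p.Prime → ∀ e : ℕ, 2 ≤ e → NoEternalConstOrderIsolatedChainPerfect p 3 (p * e))
    (hW3 : ∀ p : ℕ, p.Prime → ∀ e : ℕ, 2 ≤ e → NoEternalConstOrderIsolatedChainImperfect p 3 (p * e))
    (hD3a : LowTowerExistsTwo) (hD3c : LowTowerTamingTwo)
    (hL' : Literature.AlgebraicGeometry.Resolution.Lipman1978NoEternalNormalisedBranch.{0})
    (hCP' : Literature.AlgebraicGeometry.Resolution.CossartPiltant2019LocalPermissible.{0}) : EternalSteeredRunTwo :=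
  eternalSteeredRunTwo_of_slate2H normalAtGeneratorTwo_holds noHeightOneCarrierTwo_holds finitelyHitThreadTwoN_holds hitHeightLtTwoN_holds
    (strippingTailHighConclTwoN_of_pieces hΘ hG4 hFBw) hB₂ hC₂ hA3
    (noEternalStrippedRadicandChainH_two_of_lipmanNormalised hL')
    (noEternalStrippedRadicandChainH_three_of_pieces hG3 hW3)
    (lowOrderTailConclTwoN_of_lipman lowOrderStep_holds
      (lowRunTamedMixedBranchTwo_of_pieces' lowSurfaceStepExitsTwo_holds hD3a lowTowerPointStepsIOTwo_holds hD3c lowTowerSingularTwo_holds)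
      tamedMixedBranchReduction_holds)
    hL'.toNormalBranch hL'.toValuativeQuadraticSequence hCP'

/-! ##### tame / wild steps of a constant-order chain (was §σ2.26b; ASIDE vocabulary — the T-line uses the perfect/imperfect split; RULINGS 78/86b) -/

/-- OURS: the step `S₀ ≤ S₁` of local subrings is TAME (residually separable): every residue class of `S₁` is a SIMPLE root of a polynomial
with coefficients in `S₀` — i.e. the residue field extension `κ(S₀) → κ(S₁)` is separable algebraic (first-order phrasing, no residue-field
maps needed). Perfect `κ(S₀)` + finite extension ⇒ tame; the 4-dimensional run's members (`ZeroDim`, `k` perfect) give tame chains ONLY when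
the centres are residually separable over the previous member — NOT automatic. [folklore] -/
def IsTameStep (S₀ S₁ : Subring K) [IsLocalRing S₁] (h : S₀ ≤ S₁) : Prop :=
  ∀ y : S₁, ∃ q : Polynomial S₀, q.eval₂ (Subring.inclusion h) y ∈ maximalIdeal S₁ ∧
    (Polynomial.derivative q).eval₂ (Subring.inclusion h) y ∉ maximalIdeal S₁

/-- **G-tame(c, d)** (ASIDE): G(c, d) v2 restricted to chains all of whose steps are TAME (`IsTameStep`). OURS. [folklore] -/
def NoEternalConstOrderTameChain (p c d : ℕ) : Prop :=
  ∀ (L : Type) [Field L] [CharP L p] (S : ℕ → Subring L) [∀ m, IsLocalRing (S m)]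
    (hle : ∀ m, S m ≤ S (m + 1)) (f g : ∀ m, S m) (x : ∀ m, S (m + 1)),
    (∀ m, IsRegularLocalRing (S m)) → (∀ m, IsExcellentRing (S m)) → (∀ m, ringKrullDim (S m) = c) →
    (∀ m, IsQuadraticTransform (S m) (S (m + 1))) →
    (∀ m, Ideal.span ((fun y : S m => (⟨(y : L), hle m y.2⟩ : S (m + 1))) '' (maximalIdeal (S m) : Set (S m)))
        = Ideal.span {x m}) →
    (∀ m, ((f (m + 1) : S (m + 1)) : L) * ((x m : S (m + 1)) : L) ^ d =
        ((f m : S m) : L) - ((g m : S m) : L) ^ p) →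
    (∀ m, ∃ h : S m, f m - h ^ p ∈ maximalIdeal (S m) ^ p) →
    (∀ m (h : S m), f m - h ^ p ∉ maximalIdeal (S m) ^ (d + 1)) →
    (∀ m, HasCleaningDerivations p (S m) (f m) (g m)) →
    (∀ m, HasIsolatedSingularity (RadicandRing (S m) p (f m))) →
    (∀ m, IsTameStep (S m) (S (m + 1)) (hle m)) →
    False

/-- **G-wild(c, d)** (ASIDE): G(c, d) v2 for chains with INFINITELY MANY wild steps. OURS. [folklore] -/
def NoEternalConstOrderWildChain (p c d : ℕ) : Prop :=
  ∀ (L : Type) [Field L] [CharP L p] (S : ℕ → Subring L) [∀ m, IsLocalRing (S m)]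
    (hle : ∀ m, S m ≤ S (m + 1)) (f g : ∀ m, S m) (x : ∀ m, S (m + 1)),
    (∀ m, IsRegularLocalRing (S m)) → (∀ m, IsExcellentRing (S m)) → (∀ m, ringKrullDim (S m) = c) →
    (∀ m, IsQuadraticTransform (S m) (S (m + 1))) →
    (∀ m, Ideal.span ((fun y : S m => (⟨(y : L), hle m y.2⟩ : S (m + 1))) '' (maximalIdeal (S m) : Set (S m)))
        = Ideal.span {x m}) →
    (∀ m, ((f (m + 1) : S (m + 1)) : L) * ((x m : S (m + 1)) : L) ^ d =
        ((f m : S m) : L) - ((g m : S m) : L) ^ p) →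
    (∀ m, ∃ h : S m, f m - h ^ p ∈ maximalIdeal (S m) ^ p) →
    (∀ m (h : S m), f m - h ^ p ∉ maximalIdeal (S m) ^ (d + 1)) →
    (∀ m, HasCleaningDerivations p (S m) (f m) (g m)) →
    (∀ m, HasIsolatedSingularity (RadicandRing (S m) p (f m))) →
    (∀ m₀ : ℕ, ∃ m, m₀ ≤ m ∧ ¬ IsTameStep (S m) (S (m + 1)) (hle m)) →
    False

/-- G(c, d) ⟸ G-tame(c, d) ∧ G-wild(c, d) (tail shift past the last wild step). Pure logic. OURS. [folklore] -/
theorem noEternalConstOrderIsolatedChain_of_tame_of_wild {p c d : ℕ}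
    (hT : NoEternalConstOrderTameChain p c d) (hW : NoEternalConstOrderWildChain p c d) :
    NoEternalConstOrderIsolatedChain p c d := by
  intro L _ _ S _ hle f g x hreg hexc hdim hqt hspan hlaw hmult hopt hH hiso
  by_cases h : ∃ m₀ : ℕ, ∀ m, m₀ ≤ m → IsTameStep (S m) (S (m + 1)) (hle m)
  · obtain ⟨m₀, hm₀⟩ := h
    haveI : ∀ n, IsLocalRing ((fun n => S (m₀ + n)) n) := fun n => inferInstance
    exact hT L (fun n => S (m₀ + n)) (fun n => hle (m₀ + n)) (fun n => f (m₀ + n)) (fun n => g (m₀ + n))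
      (fun n => x (m₀ + n)) (fun n => hreg (m₀ + n)) (fun n => hexc (m₀ + n)) (fun n => hdim (m₀ + n))
      (fun n => hqt (m₀ + n)) (fun n => hspan (m₀ + n)) (fun n => hlaw (m₀ + n)) (fun n => hmult (m₀ + n))
      (fun n h => hopt (m₀ + n) h) (fun n => hH (m₀ + n)) (fun n => hiso (m₀ + n)) (fun n => hm₀ (m₀ + n) (Nat.le_add_right _ _))
  · push Not at h
    exact hW L S hle f g x hreg hexc hdim hqt hspan hlaw hmult hopt hH hiso h



/-- **THE T-LINE OF RECORD (r35)** — `eternalSteeredRunTwo_of_slate7` (res-L0-w41-strat-2's §σ2.26 v2 re-cut, 12 binders, (B2)/(C)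
discharged in-file by res-type-096 / res-D-pv-011) with **hD3c `LowTowerTamingTwo` FED BY NAME** from res-type-062's landed
`LowTaming.lowTowerTaming` (p524756; leaf `lowTowerTamingTwo_holds`, plan-1 RULING 92):
T ⇐ FRONTIER {F-A1 `hB₂`, F-A2 `hC₂`, F-B-wild `hFBw`, G-TAME(4) `hG4`, W(3) `hW3`} · RUNG {G-perf(3) `hG3`} · WORK {Θ♮ `hΘ` (res-D-pv-011),
Θ1♭+H `hA3` (`StrippedThreadTwoNH`, res-D-pv-003 + (L7) res-D-pv-004), D3a `hD3a` (res-D-pv-012)} · FACTS {hL′ Lipman 1978 (A), hCP′ CP 2019}.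
11 binders. Pure logic. OURS. [folklore] -/
theorem eternalSteeredRunTwo_of_slate7'
    (hΘ : PointTailChainTwoN) (hFBw : StrippingTailWildConclTwoN)
    (hB₂ : BirthWanderHighConclTwoN) (hC₂ : BranchWanderHighConclTwoN)
    (hA3 : StrippedThreadTwoNH)
    (hG4 : ∀ p : ℕ, p.Prime → ∀ e : ℕ, 2 ≤ e → NoEternalConstOrderIsolatedChainPerfect p 4 (p * e))
    (hG3 : ∀ p : ℕ, p.Prime → ∀ e : ℕ, 2 ≤ e → NoEternalConstOrderIsolatedChainPerfect p 3 (p * e))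
    (hW3 : ∀ p : ℕ, p.Prime → ∀ e : ℕ, 2 ≤ e → NoEternalConstOrderIsolatedChainImperfect p 3 (p * e))
    (hD3a : LowTowerExistsTwo)
    (hL' : Literature.AlgebraicGeometry.Resolution.Lipman1978NoEternalNormalisedBranch.{0})
    (hCP' : Literature.AlgebraicGeometry.Resolution.CossartPiltant2019LocalPermissible.{0}) : EternalSteeredRunTwo :=
  eternalSteeredRunTwo_of_slate7 hΘ hFBw hB₂ hC₂ hA3 hG4 hG3 hW3 hD3a lowTowerTamingTwo_holds hL' hCP'

end SteeredTwo

end Summit.ResolutionOfSingularities.ResolutionOfSingularities.Theorems.SwitchingDichotomy.Words
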